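import Summits.BirchSwinnertonDyer.BirchSwinnertonDyer.Theorems.SignedBaseChangeAnticyclotomicEisensteinDivisibilityControlTorsion
import Literature.NumberTheory.EllipticCurves.TwoVariableAnticyclotomicControlLocalProofs
import Literature.NumberTheory.EllipticCurves.HeegnerPointsKolyvaginTorsionProofs
import Literature.NumberTheory.EllipticCurves.YanZhu2026.GreenbergMainTheoremsAnyRoot
import HarnessLib

/-!
# `stub_torsionSS` (crux `AnticyclotomicEisensteinDivisibility`, stmt-BirchSwinnertonDyer-20727, line
# `bdpline`) from THREE one-variable / local inputs: `X_ac` `Λ`-torsion, the Serre-type vanishing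
# `E[p^∞]^{Gal(K̄/K̃_∞) ⊓ I_v̄} = 0`, and the away-from-`p` discrepancy over `K_∞⁻`

Width seat bsd-line-sbc-p1-w2 gen 2 (2026-08-28). Sequel of `…ControlTorsion.lean` (p613583:
`Module.IsTorsion Λ₂ X_Gr₂ ⟸ X_ac Λ-torsion + Λ-cotorsion of the local discrepancy
Q = res⁻¹(H¹_{nr,v̄}(K̃_∞, E[p^∞])) / Sel_v̄(K_∞⁻, E[p^∞])`) and of the Literature files
`CyclotomicZpExtensionUnramifiedAwayPProofs` (p615989: away from `p` the unramified conditions over `K̃_∞`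
and `K_∞⁻` coincide, `κ₁` cyclotomic) and `TwoVariableAnticyclotomicControlLocalProofs` (Greenberg at `v̄`
over `K̃_∞` ⟹ strict at `v̄` over `K_∞⁻` when `E[p^∞]^{pairKer ⊓ I_v̄} = 0`; so
`res⁻¹(H¹_{nr,v̄}(K̃_∞, M)) = datumStrictSelmer (ker κ₂) M p (bdpData M p v̄) ∅`). Putting them together,
the discrepancy `Q` is cut down to the ONE-variable quotient
`Q₁ = datumStrictSelmer (ker κ₂) E[p^∞] p (bdpData v̄) ∅ / Sel_v̄(K_∞⁻, E[p^∞])` — classes over `K_∞⁻`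
unramified away from `p` and strict at `v̄`, modulo those TRIVIAL away from `p`, at `∞`, and strict at
`v̄`: Castella 2018 §2.2 (eq:defs) `⊕_{w ∤ p} ℋ^ur_w` (+ the archimedean kernels), which on the Heegner
leaf of this crux vanishes place by place (split bad primes are finitely decomposed with pro-`p′` residual
Galois group; good primes have `E[p^∞]/(Frob − 1) = 0`; `K` imaginary quadratic has no real place) —
none of which is proved here.

* `xGr₂_isTorsion_of_isTorsion_XAc_of_vanishing_of_away` (general binders: `W` elliptic over a number
  field `K`, `E(K)[p] = 0`, `κ₁` cyclotomic, generator pair, `p ∈ v̄`): **`Module.IsTorsion Λ₂ X_Gr₂` ⟸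
  (a) `Module.IsTorsion Λ X_ac` ∧ (V) `E[p^∞]^{pairKer κ₁ κ₂ ⊓ I_v̄} = 0` ∧ (b₁) every character of
  `S = H¹_{nr,v̄}(K̃_∞, E[p^∞])` vanishing on `res(Sel_v̄(K_∞⁻))` is killed, on
  `res(datumStrictSelmer (ker κ₂) … ∅)`, by some `g ≠ 0` in `ℤ_p⟦T₂⟧`** (the dual of `Q₁` is `Λ`-torsion,
  pointwise form).
* `stub_torsionSS_of_isTorsion_XAc_of_vanishing_of_away`: the same with the telescope binders of the
  registered stub `stub_torsionSS` (bdpline v8–v11) copied verbatim after its two unused named-fact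
  antecedents (`E(K)[p] = 0` from `Surj` + imaginary quadratic, `torsionBy_eq_bot_of_isImaginaryQuadratic`;
  `κ₁.IsCyclotomic` and `p ∈ v̄` ARE binders of the stub) — a reshape template:
  `stub_torsionSS := … (stub_torsionAcSS …) (stub_inertiaVanishingSS …) (stub_awayDiscrepancySS …)`.
  (V) is Serre, Invent. Math. 15 (1972) Prop. 12 in the supersingular split setting (inertia acts on
  `E[p]` through a non-split Cartan subgroup; no `p`-torsion over `ℚ_p^{ab}·ℚ_p^{nr}`), to be typed as a
  Literature fact by a typer; (a) is BDP/CGLS/Kobayashi–Ota currency; (b₁) is Castella 2018 §2.2.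
Honest framing: bookkeeping over the tree's CONSTRUCTED carriers; (a), (V), (b₁) are hypotheses; BSD and
the crux are not proved here.

References: C. Skinner, E. Urban, Invent. Math. 195 (2014), Prop. 3.2.8 (p. 23); F. Castella, Camb. J.
Math. 6 (2018), Def. 2.2, §2.2; J.-P. Serre, Invent. Math. 15 (1972), Prop. 12; R. Greenberg, LNM 1716
(1999), §3; B. Gross, in *L-functions and Arithmetic* (1991), §2.
-/

-- D-0017: single-problem summit, the namespace repeats the problem name by design.
set_option linter.dupNamespace false
set_option autoImplicit false

noncomputable section

open scoped Classical

open Literature.NumberTheory.EllipticCurves Literature.NumberTheory.EllipticCurves.Castella2018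
  Literature.NumberTheory.EllipticCurves.GreenbergVatsal2000

namespace Summit.BirchSwinnertonDyer.BirchSwinnertonDyer.Theorems.SignedBaseChangeAcDivControlTorsion

section General

variable {K : Type} [Field K] [NumberField K] (W : WeierstrassCurve K) (p : ℕ) [Fact p.Prime]
  (κ₁ κ₂ : ZpExtension K p) (vbar : IsDedekindDomain.HeightOneSpectrum (NumberField.RingOfIntegers K))
  (γ₁ γ₂ : Field.absoluteGaloisGroup K) [hγ : Fact (ZpExtension.IsTopGeneratorPair κ₁ κ₂ γ₁ γ₂)]
  [Fact (κ₂.IsTopGenerator γ₂)]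

/-- For `κ₁` cyclotomic and `E[p^∞]^{Gal(K̄/K̃_∞) ⊓ I_v̄} = 0`, a class `a` over `K_∞⁻` that is unramified
away from `p` and strict at `v̄` (`datumStrictSelmer (ker κ₂) E[p^∞] p (bdpData v̄) ∅`) restricts into the
Greenberg group `H¹_{nr,v̄}(K̃_∞, E[p^∞])` (the "⟸" half of
`resOfLe_mem_unrSelmer₂_iff_mem_datumStrictSelmer`; used to name the characters' arguments in (b₁)).
[cite: SkinnerUrban2014, §3.2.7 (p. 23)] -/
theorem resOfLe_mem_unrSelmer₂_of_mem_datumStrictSelmer (hκ₁ : κ₁.IsCyclotomic)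
    (hvbar : ((p : ℕ) : NumberField.RingOfIntegers K) ∈ vbar.asIdeal)
    (hV : ∀ m : W.geomPrimaryTorsion p,
      (∀ t ∈ ZpExtension.pairKer κ₁ κ₂ ⊓ GreenbergSelmer.inertia vbar, t • m = m) → m = 0)
    {a : W.subgroupH1 p κ₂.kerSubgroup}
    (ha : a ∈ datumStrictSelmer κ₂.kerSubgroup (W.geomPrimaryTorsion p) p
      (AcSelmer.bdpData (W.geomPrimaryTorsion p) p vbar) ∅) :
    W.resOfLe p (ZpExtension.pairKer_le_right κ₁ κ₂) a ∈ unrSelmer₂ κ₁ κ₂ (W.geomPrimaryTorsion p) vbar :=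
  (resOfLe_mem_unrSelmer₂_iff_mem_datumStrictSelmer hκ₁ κ₂ hvbar hV a).mpr ha

/-- **`X_Gr(E/K̃_∞)` is `Λ₂`-torsion from three one-variable / local inputs** (`W` elliptic over a number
field `K`, `E(K)[p] = 0`, `κ₁` cyclotomic, generator pair `(γ₁, γ₂)`, `p ∈ v̄`): (a) Castella's
`X_ac = Hom(Sel_v̄(K_∞⁻, E[p^∞]), ℚ/ℤ)` is `Λ`-torsion; (V) `E[p^∞]` has no non-zero point fixed by
`Gal(K̄/K̃_∞) ⊓ I_v̄`; (b₁) every character of `S = H¹_{nr,v̄}(K̃_∞, E[p^∞])` vanishing on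
`res(Sel_v̄(K_∞⁻, E[p^∞]))` is killed by some `g ≠ 0` (`g ∈ Λ = ℤ_p⟦T₂⟧`, acting as `C g`) on the
restrictions of the classes of `datumStrictSelmer (ker κ₂) E[p^∞] p (bdpData v̄) ∅` — the Pontryagin dual
of the ONE-variable away-from-`p`/archimedean discrepancy is `Λ`-torsion. Proof:
`xGr₂_isTorsion_of_isTorsion_XAc_of_local` + `resOfLe_mem_unrSelmer₂_iff_mem_datumStrictSelmer`.
[cite: SkinnerUrban2014, Prop. 3.2.8 (p. 23)] [cite: Castella2018, §2.2 (arXiv:1704.06608 p. 7)]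
[cite: Serre1972, §1 Prop. 12] -/
theorem xGr₂_isTorsion_of_isTorsion_XAc_of_vanishing_of_away [W.IsElliptic] (hκ₁ : κ₁.IsCyclotomic)
    (hvbar : ((p : ℕ) : NumberField.RingOfIntegers K) ∈ vbar.asIdeal)
    (hK : ∀ P : W.toAffine.Point, p • P = 0 → P = 0)
    (hV : ∀ m : W.geomPrimaryTorsion p,
      (∀ t ∈ ZpExtension.pairKer κ₁ κ₂ ⊓ GreenbergSelmer.inertia vbar, t • m = m) → m = 0)
    (hac : Module.IsTorsion (IwasawaAlgebra p) (AcSelmer.XAc W p κ₂ vbar ∅ γ₂))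
    (hQ₁ : ∀ x : W.XGr₂ p κ₁ κ₂ vbar γ₁ γ₂,
      (∀ s : AcSelmer.selmerAc W p κ₂ vbar ∅, x (W.selmerAcToUnrSelmer₂ p κ₁ κ₂ vbar s) = 0) →
        ∃ g : IwasawaAlgebra p, g ≠ 0 ∧ ∀ (a : W.subgroupH1 p κ₂.kerSubgroup)
          (ha : a ∈ datumStrictSelmer κ₂.kerSubgroup (W.geomPrimaryTorsion p) p
            (AcSelmer.bdpData (W.geomPrimaryTorsion p) p vbar) ∅),
          ((PowerSeries.C g : IwasawaAlgebra₂ p) • x)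
            ⟨_, resOfLe_mem_unrSelmer₂_of_mem_datumStrictSelmer W p κ₁ κ₂ vbar hκ₁ hvbar hV ha⟩ = 0) :
    Module.IsTorsion (IwasawaAlgebra₂ p) (W.XGr₂ p κ₁ κ₂ vbar γ₁ γ₂) := by
  refine xGr₂_isTorsion_of_isTorsion_XAc_of_local W p κ₁ κ₂ vbar γ₁ γ₂ hK hac fun x hx ↦ ?_
  obtain ⟨g, hg0, hg⟩ := hQ₁ x hx
  refine ⟨g, hg0, fun a ha ↦ ?_⟩
  exact hg a ((resOfLe_mem_unrSelmer₂_iff_mem_datumStrictSelmer hκ₁ κ₂ hvbar hV a).mp ha)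

end General

/-- **`stub_torsionSS` ⟸ (a) `X_ac` `Λ`-torsion + (V) inertia vanishing at `v̄` + (b₁) away-from-`p`
discrepancy**, with the telescope binders of the registered stub of line `bdpline` copied verbatim after
the two unused named-fact antecedents (`κ₁.IsCyclotomic` and `p ∈ v̄` are among them; `E(K)[p] = 0` is
discharged from `Surj`, `p ≠ 2`, `K` imaginary quadratic by `torsionBy_eq_bot_of_isImaginaryQuadratic`).
A reshape template for the next lead: three one-variable / local stubs in place of the two-variable one.
[cite: SkinnerUrban2014, Prop. 3.2.8 (p. 23)] [cite: Castella2018, Def. 2.2 and §2.2 (arXiv:1704.06608 pp. 5, 7)]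
[cite: GrossLMS1991, §2 (after (2.2))] -/
theorem stub_torsionSS_of_isTorsion_XAc_of_vanishing_of_away :
    ∀ (W : WeierstrassCurve ℚ) [W.IsElliptic] [W.IsGloballyMinimal] (p : ℕ) [Fact p.Prime], 5 ≤ p → W.HasGoodReductionAtPrime p → W.frobeniusTrace p = 0 → Literature.NumberTheory.EllipticCurves.Rank1Residual.Surj W p → ∀ (K : Type) [Field K] [NumberField K] (ι : PadicAlgCl p ≃+* ℂ) (v vbar : IsDedekindDomain.HeightOneSpectrum (NumberField.RingOfIntegers K)) (κ₁ κ₂ : Literature.NumberTheory.EllipticCurves.ZpExtension K p) (γ₁ γ₂ : Field.absoluteGaloisGroup K) [Fact (Literature.NumberTheory.EllipticCurves.ZpExtension.IsTopGeneratorPair κ₁ κ₂ γ₁ γ₂)] [NeZero (NumberField.discr K).natAbs] (N : ℕ) [NeZero N] (f : CuspForm (CongruenceSubgroup.Gamma0 N) 2), Literature.NumberTheory.EllipticCurves.ModularForms.IsNewformOf W f → (N : ℤ) = W.conductorNorm ℤ → Literature.NumberTheory.EllipticCurves.IsImaginaryQuadratic K → ((Ideal.span {(p : ℤ)}).primesOver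 (NumberField.RingOfIntegers K)).ncard = 2 → ((p : ℕ) : NumberField.RingOfIntegers K) ∈ v.asIdeal → ((p : ℕ) : NumberField.RingOfIntegers K) ∈ vbar.asIdeal → vbar ≠ v → (∀ (w : NumberField.InfinitePlace K) (k : NumberField.RingOfIntegers K), k ∈ v.asIdeal ↔ ‖ι.symm (w.embedding (k : K))‖ < 1) → IsCoprime (N : ℤ) (NumberField.discr K) → (∀ ℓ : ℕ, ℓ.Prime → ℓ ∣ N → ((Ideal.span {(ℓ : ℤ)}).primesOver (NumberField.RingOfIntegers K)).ncard = 2) → Odd (NumberField.discr K) → NumberField.discr K ≠ -3 → ∀ (hκ₁ : κ₁.IsCyclotomic), κ₂.IsAnticyclotomic →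
      -- (a) one-variable anticyclotomic torsion (print currency)
      (haveI : Fact (κ₂.IsTopGenerator γ₂) := ⟨Literature.NumberTheory.EllipticCurves.YanZhu2026.isTopGenerator_of_pair (κ₁ := κ₁) (γ₁ := γ₁)⟩; Module.IsTorsion (Literature.NumberTheory.EllipticCurves.IwasawaAlgebra p) (Literature.NumberTheory.EllipticCurves.Castella2018.AcSelmer.XAc (W.baseChange K) p κ₂ vbar ∅ γ₂)) →
      -- (V) inertia vanishing at `v̄`: `E[p^∞]^{Gal(K̄/K̃_∞) ⊓ I_v̄} = 0` (Serre 1972 Prop. 12 shape)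
      ∀ (hV : ∀ m : (W.baseChange K).geomPrimaryTorsion p,
        (∀ t ∈ Literature.NumberTheory.EllipticCurves.ZpExtension.pairKer κ₁ κ₂ ⊓ Literature.NumberTheory.EllipticCurves.GreenbergSelmer.inertia vbar, t • m = m) → m = 0),
      -- (b₁) the one-variable away-from-`p` / archimedean discrepancy is `Λ`-cotorsion (Pontryagin-dual form)
      (∀ (hvbar : ((p : ℕ) : NumberField.RingOfIntegers K) ∈ vbar.asIdeal) (x : (W.baseChange K).XGr₂ p κ₁ κ₂ vbar γ₁ γ₂),
        (∀ s : Literature.NumberTheory.EllipticCurves.Castella2018.AcSelmer.selmerAc (W.baseChange K) p κ₂ vbar ∅,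
          x ((W.baseChange K).selmerAcToUnrSelmer₂ p κ₁ κ₂ vbar s) = 0) →
        ∃ g : Literature.NumberTheory.EllipticCurves.IwasawaAlgebra p, g ≠ 0 ∧
          ∀ (a : (W.baseChange K).subgroupH1 p κ₂.kerSubgroup)
            (ha : a ∈ Literature.NumberTheory.EllipticCurves.GreenbergVatsal2000.datumStrictSelmer κ₂.kerSubgroup ((W.baseChange K).geomPrimaryTorsion p) p
              (Literature.NumberTheory.EllipticCurves.Castella2018.AcSelmer.bdpData ((W.baseChange K).geomPrimaryTorsion p) p vbar) ∅),
            ((PowerSeries.C g : Literature.NumberTheory.EllipticCurves.IwasawaAlgebra₂ p) • x)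
              ⟨_, resOfLe_mem_unrSelmer₂_of_mem_datumStrictSelmer (W.baseChange K) p κ₁ κ₂ vbar hκ₁ hvbar hV ha⟩ = 0) →
      Module.IsTorsion (Literature.NumberTheory.EllipticCurves.IwasawaAlgebra₂ p) ((W.baseChange K).XGr₂ p κ₁ κ₂ vbar γ₁ γ₂) := by
  intro W _ _ p _ hp _ _ hs K _ _ ι v vbar κ₁ κ₂ γ₁ γ₂ _ _ N _ f _ _ hK _ _ hvbar _ _ _ _ _ _ hκ₁ _ hac hV hQ₁
  haveI hγ₂ : Fact (κ₂.IsTopGenerator γ₂) :=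
    ⟨Literature.NumberTheory.EllipticCurves.YanZhu2026.isTopGenerator_of_pair (κ₁ := κ₁) (γ₁ := γ₁)⟩
  -- `E(K)[p] = 0` from `Surj`, `p ≠ 2`, `K` imaginary quadratic
  have hp2 : p ≠ 2 := by omega
  have htor := torsionBy_eq_bot_of_isImaginaryQuadratic W K hK (Fact.out) hp2 hs
  have hKp : ∀ P : (W.baseChange K).toAffine.Point, p • P = 0 → P = 0 := fun P hP => by
    have hmem : P ∈ AddSubgroup.torsionBy (W.baseChange K).toAffine.Point (p : ℤ) :=
      AddSubgroup.torsionBy.nsmul_iff.mpr hP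
    rw [htor] at hmem
    exact AddSubgroup.mem_bot.mp hmem
  haveI : (W.baseChange K).IsElliptic := by rw [WeierstrassCurve.baseChange]; infer_instance
  exact xGr₂_isTorsion_of_isTorsion_XAc_of_vanishing_of_away (W.baseChange K) p κ₁ κ₂ vbar γ₁ γ₂ hκ₁
    hvbar hKp hV hac (hQ₁ hvbar)

end Summit.BirchSwinnertonDyer.BirchSwinnertonDyer.Theorems.SignedBaseChangeAcDivControlTorsion

end
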